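import Literature.Barriers.CriticalPhenomena.LaceExpansionIsingDeconvolution
import HarnessLib

/-!
# The forbidden-interval step of Liu–Slade's bootstrap (proof of Theorem 1.7, §2.2)

Barrier catalogue `Literature/Barriers/CriticalPhenomena/` (D-0021), companion of
`LaceExpansionIsingDeconvolution.lean` (objects `LSAssumptionG`, `LSBootstrapLE`) and of
`LaceExpansionIsingDeconvolutionParts.lean` (the decomposition of Liu–Slade 2026, Theorem 1.7).
This file PROVES the purely real-variable part of the proof of Theorem 1.7 (Liu–Slade 2026, §2.2,
first paragraph of the proof): "By Proposition 2.3 and continuity of the function `b`, the interval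
`(2,3]` is forbidden for values of `b(z)` when `z ∈ [1, z_c)`. Since `b(1) ≤ 1` by
Assumption 1.3(iv), we must have `b(z) ≤ 2` for all `z ∈ [1, z_c)`. It then follows from
Assumption 1.3(iii) that `G_{z_c}(x) = lim_{z → z_c⁻} G_z(x) ≤ 2 K_S/(L^{2-ε}|x|^{d-2})` (`x ≠ 0`)",
for the bootstrap function
`b(z) = max{ sup_{x ≠ 0} G_z(x)/(K_S L^{-2+ε}|x|^{-(d-2)}), 3(z-1) }` of (1.12), whose sublevel
predicates "`b(z) ≤ t`" are the `LSBootstrapLE … t` of the parent file.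

The source invokes "continuity of `b`" ("finite and continuous in `z ∈ [1, z_c)` by
Assumption 1.3(ii)–(iii)"). We prove the conclusion directly from Assumption 1.3 without
packaging `b` as a real function (it is a supremum over infinitely many `x`): `b` is
left-continuous in the sense that "`b ≤ t` on `[1, z⋆)`" passes to `z⋆` (continuity (iii) of
each `G_·(x)`, `lsBootstrapLE_of_forall_lt`), and right upper-semicontinuous in the sense needed —
if `b(z⋆) ≤ 2` then `b ≤ 3` on a right neighbourhood of `z⋆` — because the decay (ii) at one
`z' ∈ (z⋆, z_c)` and the monotonicity (iii) reduce the supremum over `x` to a finite set, on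
which continuity (iii) applies (`forall_lsBootstrapLE_two`, by an infimum argument).

## Contents (all proved)

* `LSBootstrapLE.mono` — `b(z) ≤ t ≤ t' ⇒ b(z) ≤ t'`;
* `lsBootstrapLE_one_of_le_green` — `b(1) ≤ 1` from Assumption 1.3(iv) and the bound (1.10) on
  `S_1` ("and `b(1) ≤ 1` by Assumption 1.3(iv)", §1.2.2);
* `lsBootstrapLE_of_forall_lt` — `b ≤ t` on `[1, z⋆)` and `1 < z⋆ ≤ z_c` imply `b(z⋆) ≤ t`
  (the step "`G_{z_c}(x) = lim_{z → z_c⁻} G_z(x) ≤ …`", (2.18));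
* `forall_lsBootstrapLE_two` — the forbidden-interval conclusion: if `b(1) ≤ 2` and
  `b(z) ≤ 3 ⇒ b(z) ≤ 2` for every `z ∈ [1, z_c)` (Prop. 2.3), then `b(z) ≤ 2` for all
  `z ∈ [1, z_c]`.

## References

* Y. Liu, G. Slade, *Gaussian deconvolution and the lace expansion for spread-out models*,
  Ann. Inst. H. Poincaré Probab. Statist. 62 (2026), arXiv:2310.07640: §1.2.2 ((1.12), "The
  function `b(z)` is finite and continuous in `z ∈ [1,z_c)` by Assumption 1.3(ii)–(iii), and
  `b(1) ≤ 1` by Assumption 1.3(iv)"), Prop. 2.3, proof of Thm. 1.7 (first paragraph) and (2.18)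
  [LiuSlade2026].
-/

noncomputable section

namespace Literature.Barriers.CriticalPhenomena.SpreadOutIsing

open Filter Literature.Probability.LatticeModels
open _root_.Topology

variable {d L : ℕ} {ε K_S : ℝ} {G : ℝ → Site d → ℝ} {zc : ℝ}

/-! ## Elementary properties of the sublevel predicates `b(z) ≤ t` -/

/-- The comparison function `K_S L^{-(2-ε)} |x|^{-(d-2)}` of the bootstrap is nonnegative for
`K_S ≥ 0`. [cite: LiuSlade2026, (1.12)] -/
theorem bootstrapBound_nonneg (hK : 0 ≤ K_S) (x : Site d) :
    0 ≤ K_S * (L : ℝ) ^ (-(2 - ε)) * euclidNorm x ^ (-((d : ℝ) - 2)) :=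
  mul_nonneg (mul_nonneg hK (Real.rpow_nonneg (Nat.cast_nonneg L) _))
    (Real.rpow_nonneg (euclidNorm_nonneg x) _)

/-- The comparison function `K_S L^{-(2-ε)} |x|^{-(d-2)}` is positive at `x ≠ 0` for `K_S > 0`,
`L ≥ 1`. [cite: LiuSlade2026, (1.12)] -/
theorem bootstrapBound_pos (hK : 0 < K_S) (hL : 1 ≤ L) {x : Site d} (hx : x ≠ 0) :
    0 < K_S * (L : ℝ) ^ (-(2 - ε)) * euclidNorm x ^ (-((d : ℝ) - 2)) := by
  have hLpos : (0 : ℝ) < L := by exact_mod_cast hL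
  have hxpos : 0 < euclidNorm x := lt_of_lt_of_le one_pos (one_le_euclidNorm_of_ne_zero hx)
  exact mul_pos (mul_pos hK (Real.rpow_pos_of_pos hLpos _)) (Real.rpow_pos_of_pos hxpos _)

/-- Monotonicity of the sublevel predicates in the level: `b(z) ≤ t` and `t ≤ t'` give
`b(z) ≤ t'` (`K_S ≥ 0`). [cite: LiuSlade2026, (1.12)] -/
theorem LSBootstrapLE.mono {Gz : Site d → ℝ} {z t t' : ℝ} (h : LSBootstrapLE d L ε K_S Gz z t)
    (htt' : t ≤ t') (hK : 0 ≤ K_S) : LSBootstrapLE d L ε K_S Gz z t' :=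
  ⟨fun x hx => (h.1 x hx).trans (mul_le_mul_of_nonneg_right htt' (bootstrapBound_nonneg hK x)),
    h.2.trans htt'⟩

/-- **`b(1) ≤ 1`** ("by Assumption 1.3(iv)", §1.2.2): the random-walk bound `G_1 ≤ S_1` and the
Green-function bound (1.10), `S_1(x) ≤ δ_{0,x} + K_S L^{-(2-ε)}⟦x⟧^{-(d-2)}`, give
`G_1(x) ≤ K_S L^{-(2-ε)}|x|^{-(d-2)}` for `x ≠ 0` (where `⟦x⟧ = |x|`), and `3(1-1) = 0 ≤ 1`.
[cite: LiuSlade2026, §1.2.2 ("b(1) ≤ 1 by Assumption 1.3(iv)") and (1.10)] -/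
theorem lsBootstrapLE_one_of_le_green (hG : LSAssumptionG d L G zc)
    (hS : ∀ x : Site d, soGreen d L 1 x ≤
      delta0 x + K_S * (L : ℝ) ^ (-(2 - ε)) * jnorm x ^ (-((d : ℝ) - 2))) :
    LSBootstrapLE d L ε K_S (G 1) 1 1 := by
  refine ⟨fun x hx => ?_, by norm_num⟩
  have h := (hG.le_green x).trans (hS x)
  rw [delta0_of_ne_zero hx, zero_add, jnorm_eq_euclidNorm (one_le_euclidNorm_of_ne_zero hx)] at h
  simpa only [one_mul] using h

/-- **Left passage to the limit in `z`** (the step (2.18), "`G_{z_c}(x) = lim_{z → z_c⁻} G_z(x) ≤ 2K_S/(L^{2-ε}|x|^{d-2})`"):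
if `b(z) ≤ t` for all `z ∈ [1, z⋆)` and `1 < z⋆ ≤ z_c`, then `b(z⋆) ≤ t`, by the continuity of
each `z ↦ G_z(x)` on `[1, z_c]` (Assumption 1.3(iii)) and of `z ↦ 3(z-1)`.
[cite: LiuSlade2026, proof of Theorem 1.7, (2.18)] -/
theorem lsBootstrapLE_of_forall_lt (hG : LSAssumptionG d L G zc) {t zs : ℝ}
    (hzs : zs ∈ Set.Ioc 1 zc) (h : ∀ z ∈ Set.Ico 1 zs, LSBootstrapLE d L ε K_S (G z) z t) :
    LSBootstrapLE d L ε K_S (G zs) zs t := by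
  obtain ⟨h1zs, hzszc⟩ := hzs
  have hsub : Set.Ico 1 zs ⊆ Set.Icc 1 zc := fun z hz => ⟨hz.1, hz.2.le.trans hzszc⟩
  refine ⟨fun x hx => ?_, ?_⟩
  · -- `G_{z⋆}(x) = lim_{z ↑ z⋆} G_z(x) ≤ t · bound`
    have hcont : ContinuousWithinAt (fun z => G z x) (Set.Ico 1 zs) zs :=
      ((hG.continuousOn x).continuousWithinAt ⟨h1zs.le, hzszc⟩).mono hsub
    have htend : Tendsto (fun z => G z x) (𝓝[<] zs) (𝓝 (G zs x)) := by
      have := hcont.tendsto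
      rwa [nhdsWithin_Ico_eq_nhdsLT h1zs] at this
    refine le_of_tendsto htend ?_
    rw [← nhdsWithin_Ico_eq_nhdsLT h1zs]
    exact eventually_nhdsWithin_of_forall fun z hz => (h z hz).1 x hx
  · -- `3(z⋆ - 1) ≤ t` by density
    by_contra hlt
    rw [not_le] at hlt
    -- pick `z ∈ [1, z⋆)` with `3(z-1) > t`
    set z : ℝ := max 1 ((zs + (1 + t / 3)) / 2) with hz
    have hz1 : 1 ≤ z := le_max_left _ _
    have hzt : 1 + t / 3 < zs := by linarith
    have hzlt : z < zs := max_lt h1zs (by linarith)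
    have hz3 : t < 3 * (z - 1) := by
      have : (zs + (1 + t / 3)) / 2 ≤ z := le_max_right _ _
      linarith
    have := (h z ⟨hz1, hzlt⟩).2
    linarith

/-- **The forbidden-interval argument** (Liu–Slade 2026, proof of Theorem 1.7, first paragraph):
"By Proposition 2.3 and continuity of the function `b`, the interval `(2,3]` is forbidden for
values of `b(z)` when `z ∈ [1, z_c)`. Since `b(1) ≤ 1` …, we must have `b(z) ≤ 2` for all
`z ∈ [1, z_c)`", together with the passage to `z_c` of (2.18). Hypotheses: Assumption 1.3
(`LSAssumptionG`), `K_S > 0`, `L ≥ 1`, `b(1) ≤ 2`, and the bootstrap implication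
`b(z) ≤ 3 ⇒ b(z) ≤ 2` on `[1, z_c)`; conclusion: `b(z) ≤ 2` on `[1, z_c]`. Proof: were the set of
failures in `[1, z_c)` nonempty, its infimum `z⋆` would satisfy `b(z⋆) ≤ 2` (left passage, or
`z⋆ = 1`), hence — by the decay (ii) at some `z' ∈ (z⋆, z_c)`, the monotonicity (iii), and the
continuity (iii) on the finitely many remaining `x` — `b ≤ 3`, so `b ≤ 2`, on a right
neighbourhood of `z⋆`, contradicting the choice of `z⋆`. [cite: LiuSlade2026, proof of Theorem 1.7 (first paragraph) and (2.18); §1.2.2 (continuity of b from Assumption 1.3(ii)–(iii))] -/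
theorem forall_lsBootstrapLE_two (hG : LSAssumptionG d L G zc) (hK : 0 < K_S) (hL : 1 ≤ L)
    (h1 : LSBootstrapLE d L ε K_S (G 1) 1 2)
    (hstep : ∀ z ∈ Set.Ico 1 zc,
      LSBootstrapLE d L ε K_S (G z) z 3 → LSBootstrapLE d L ε K_S (G z) z 2) :
    ∀ z ∈ Set.Icc 1 zc, LSBootstrapLE d L ε K_S (G z) z 2 := by
  -- notation
  set bnd : Site d → ℝ := fun x => K_S * (L : ℝ) ^ (-(2 - ε)) * euclidNorm x ^ (-((d : ℝ) - 2))
    with hbnd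
  have hbnd_pos : ∀ x : Site d, x ≠ 0 → 0 < bnd x := fun x hx => bootstrapBound_pos hK hL hx
  -- Step 1: `b ≤ 2` on `[1, z_c)`, by the infimum argument
  have hIco : ∀ z ∈ Set.Ico 1 zc, LSBootstrapLE d L ε K_S (G z) z 2 := by
    by_contra hcon
    push Not at hcon
    set S : Set ℝ := {z | z ∈ Set.Ico 1 zc ∧ ¬LSBootstrapLE d L ε K_S (G z) z 2} with hS
    have hSne : S.Nonempty := by
      obtain ⟨z₀, hz₀, hP⟩ := hcon
      exact ⟨z₀, hz₀, hP⟩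
    have hSbdd : BddBelow S := ⟨1, fun z hz => hz.1.1⟩
    set zs : ℝ := sInf S with hzs
    have hzs1 : 1 ≤ zs := le_csInf hSne fun z hz => hz.1.1
    have hzszc : zs < zc := by
      obtain ⟨z₀, hz₀, hP⟩ := hcon
      exact (csInf_le hSbdd ⟨hz₀, hP⟩).trans_lt hz₀.2
    -- (a) `b ≤ 2` strictly below `z⋆`
    have hbelow : ∀ z ∈ Set.Ico 1 zs, LSBootstrapLE d L ε K_S (G z) z 2 := by
      intro z hz
      by_contra hP
      have : zs ≤ z := csInf_le hSbdd ⟨⟨hz.1, hz.2.trans hzszc⟩, hP⟩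
      exact absurd hz.2 (not_lt.2 this)
    -- (b) `b(z⋆) ≤ 2`
    have hat : LSBootstrapLE d L ε K_S (G zs) zs 2 := by
      rcases eq_or_lt_of_le hzs1 with h | h
      · rw [← h]; exact h1
      · exact lsBootstrapLE_of_forall_lt hG ⟨h, hzszc.le⟩ hbelow
    -- (c) `b ≤ 3` on a right neighbourhood of `z⋆` within `[1, z_c]`
    set z' : ℝ := (zs + zc) / 2 with hz'
    have hzsz' : zs < z' := by rw [hz']; linarith
    have hz'zc : z' < zc := by rw [hz']; linarith
    have hz'I : z' ∈ Set.Ico 1 zc := ⟨by linarith, hz'zc⟩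
    -- the exceptional finite set from the decay (ii) at `z'`
    have hdec := hG.decay_subcrit z' hz'I
    have hc3 : (0 : ℝ) < 3 * (K_S * (L : ℝ) ^ (-(2 - ε))) := by
      have hLpos : (0 : ℝ) < L := by exact_mod_cast hL
      have := Real.rpow_pos_of_pos hLpos (-(2 - ε))
      positivity
    have hev : ∀ᶠ x in cofinite, G z' x * euclidNorm x ^ ((d : ℝ) - 2) < 3 * (K_S * (L : ℝ) ^ (-(2 - ε))) :=
      hdec.eventually_lt_const hc3
    rw [Filter.eventually_cofinite] at hev
    set E : Set (Site d) := {x | ¬G z' x * euclidNorm x ^ ((d : ℝ) - 2) < 3 * (K_S * (L : ℝ) ^ (-(2 - ε)))}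
      with hE
    have hEfin : E.Finite := hev
    -- off `E`: `G_z(x) ≤ G_{z'}(x) < 3 · bnd x` for `z ∈ [1, z']`
    have hoff : ∀ x : Site d, x ≠ 0 → x ∉ E → ∀ z ∈ Set.Icc 1 zc, z ≤ z' → G z x ≤ 3 * bnd x := by
      intro x hx hxE z hz hzz'
      have hxE' : G z' x * euclidNorm x ^ ((d : ℝ) - 2) < 3 * (K_S * (L : ℝ) ^ (-(2 - ε))) := by
        by_contra hh; exact hxE hh
      have hmono : G z x ≤ G z' x := hG.monotoneOn x hz ⟨hz'I.1, hz'zc.le⟩ hzz'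
      have hxpos : 0 < euclidNorm x := lt_of_lt_of_le one_pos (one_le_euclidNorm_of_ne_zero hx)
      have hpow : 0 < euclidNorm x ^ ((d : ℝ) - 2) := Real.rpow_pos_of_pos hxpos _
      have hG' : G z' x < 3 * bnd x := by
        have : G z' x = G z' x * euclidNorm x ^ ((d : ℝ) - 2) * euclidNorm x ^ (-((d : ℝ) - 2)) := by
          rw [Real.rpow_neg hxpos.le, mul_assoc, mul_inv_cancel₀ hpow.ne', mul_one]
        rw [this, hbnd]
        simp only
        have h3 : 3 * (K_S * (L : ℝ) ^ (-(2 - ε)) * euclidNorm x ^ (-((d : ℝ) - 2))) =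
            3 * (K_S * (L : ℝ) ^ (-(2 - ε))) * euclidNorm x ^ (-((d : ℝ) - 2)) := by ring
        rw [h3]
        exact mul_lt_mul_of_pos_right hxE' (Real.rpow_pos_of_pos hxpos _)
      exact hmono.trans hG'.le
    -- on `E \ {0}`: continuity at `z⋆`
    have hon : ∀ᶠ z in 𝓝[Set.Icc 1 zc] zs, ∀ x ∈ E, x ≠ 0 → G z x < 3 * bnd x := by
      rw [hEfin.eventually_all]
      intro x _
      by_cases hx : x = 0
      · exact Filter.Eventually.of_forall fun z h => absurd hx h
      · have hcont : ContinuousWithinAt (fun z => G z x) (Set.Icc 1 zc) zs :=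
          (hG.continuousOn x).continuousWithinAt ⟨hzs1, hzszc.le⟩
        have hlt : G zs x < 3 * bnd x := by
          have h2 : G zs x ≤ 2 * bnd x := hat.1 x hx
          have := hbnd_pos x hx
          linarith
        exact (hcont.tendsto.eventually_lt_const hlt).mono fun z hz _ => hz
    -- eventually `z ≤ z'` and `3(z-1) ≤ 3`
    have hz'ev : ∀ᶠ z in 𝓝[Set.Icc 1 zc] zs, z < z' :=
      mem_nhdsWithin_of_mem_nhds (Iio_mem_nhds hzsz')
    have h3ev : ∀ᶠ z in 𝓝[Set.Icc 1 zc] zs, 3 * (z - 1) < 3 := by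
      have hzs53 : zs < 2 := by have := hat.2; linarith
      exact mem_nhdsWithin_of_mem_nhds (by
        have : Set.Iio (2 : ℝ) ∈ 𝓝 zs := Iio_mem_nhds hzs53
        filter_upwards [this] with z hz
        simp only [Set.mem_Iio] at hz
        linarith)
    have hmem : ∀ᶠ z in 𝓝[Set.Icc 1 zc] zs, z ∈ Set.Icc 1 zc := eventually_mem_nhdsWithin
    -- hence eventually `b ≤ 3`, so `b ≤ 2` on `[1, z_c)`
    have hP : ∀ᶠ z in 𝓝[Set.Icc 1 zc] zs, z < zc → LSBootstrapLE d L ε K_S (G z) z 2 := by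
      filter_upwards [hon, hz'ev, h3ev, hmem] with z hzon hzz' hz3 hzI hzzc
      refine hstep z ⟨hzI.1, hzzc⟩ ⟨fun x hx => ?_, hz3.le⟩
      by_cases hxE : x ∈ E
      · exact (hzon x hxE hx).le
      · exact hoff x hx hxE z hzI hzz'.le
    -- (d) contradiction with `z⋆ = inf S`
    obtain ⟨U, hU, hUP⟩ : ∃ δ > 0, ∀ z, dist z zs < δ → z ∈ Set.Icc 1 zc →
        (z < zc → LSBootstrapLE d L ε K_S (G z) z 2) := by
      rcases Metric.mem_nhdsWithin_iff.1 hP with ⟨δ, hδ, hsub⟩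
      exact ⟨δ, hδ, fun z hz hzI => hsub ⟨hz, hzI⟩⟩
    obtain ⟨z₁, hz₁S, hz₁lt⟩ : ∃ z₁ ∈ S, z₁ < zs + U := exists_lt_of_csInf_lt hSne (by linarith)
    have hzsz₁ : zs ≤ z₁ := csInf_le hSbdd hz₁S
    have hdist : dist z₁ zs < U := by
      rw [Real.dist_eq, abs_of_nonneg (by linarith)]
      linarith
    exact hz₁S.2 (hUP z₁ hdist ⟨hz₁S.1.1, hz₁S.1.2.le⟩ hz₁S.1.2)
  -- Step 2: the endpoint `z_c`
  intro z hz
  rcases eq_or_lt_of_le hz.2 with h | h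
  · -- `z = z_c`
    rw [h]
    rcases eq_or_lt_of_le hG.one_le_zc with h1c | h1c
    · rw [← h1c]; exact h1
    · exact lsBootstrapLE_of_forall_lt hG ⟨h1c, le_rfl⟩ hIco
  · exact hIco z ⟨hz.1, h⟩

end Literature.Barriers.CriticalPhenomena.SpreadOutIsing

end
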